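import Literature.Analysis.UnboundedOperators.StrongContRepresentation
import Literature.Analysis.OperatorTheory.PseudoResolvent
import Mathlib.Analysis.SpecialFunctions.ImproperIntegrals
import HarnessLib

/-!
# The Laplace transform of an exponentially bounded C₀-semigroup (Engel–Nagel II.1.10), part 1:
  definition, bound, and eigenvectors

Analysis/UnboundedOperators support file (two definitions with bodies, everything proved, no
named facts). For a C₀-semigroup `T` (the tree's `C0Semigroup ℂ E`, `StrongContRepresentation.lean`)
on a complex Banach space with `‖T(t)‖ ≤ M e^{ωt}`, Engel–Nagel (2000), Ch. II Thm. 1.10 (with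
(1.13)–(1.14)): for `Re λ > ω`,

  `R(λ) x := ∫₀^∞ e^{−λs} T(s) x ds`

exists for every `x`, defines a bounded operator with `‖R(λ)‖ ≤ M/(Re λ − ω)`, and `R(λ)` is the
resolvent `R(λ, A)` of the generator; in particular `λ ↦ R(λ)` satisfies the resolvent equation
(Kato IX-§1.3 (1.28); Hille–Yosida). This is the bridge from the semigroups the tree constructs
(heat semigroup; the similarity-variable semigroup `e^{τ𝓛}` of Jia–Šverák 2015 behind the free
part of Albritton–Brué–Colombo's `L_ss`, which satisfies `‖e^{τ𝓛}‖ ≤ e^{−τ/4}` on `L²(ℝ³)`) to the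
pseudo-resolvent layer (`Literature.Analysis.OperatorTheory.IsPseudoResolvent`): its Laplace
transform is the resolvent family on `{Re λ > ω}` to which the Riesz-projection calculus applies.

Part 1 (this file):
* `laplaceResolventFun T λ x = ∫ t in (0,∞), e^{−λt} • T(t) x` (Bochner integral, total) and its
  integrability/continuity lemmas for `Re λ > ω`;
* `laplaceResolventCLM`: the bounded operator `x ↦ R(λ)x` with the bound
  `‖R(λ) x‖ ≤ (M ∫₀^∞ e^{(ω − Re λ)t} dt) ‖x‖` (`norm_laplaceResolventFun_le`);
* `laplaceResolventFun_of_app_eq_exp_smul`: **eigenvector transfer** — if `T(t) v = e^{μt} v`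
  for all `t ≥ 0` then `R(λ) v = (λ − μ)⁻¹ v` for `Re λ > Re μ`; this is the hypothesis
  `J(λ) v = (λ − μ)⁻¹ v` under which `IsPseudoResolvent.circleIntegral_apply_of_apply_eq_inv_smul`
  gives `P v = v` for the Riesz projection.
Part 2 (to follow): the resolvent equation `R(λ) − R(μ) = (μ − λ) R(λ) R(μ)` (one Fubini), i.e.
`IsPseudoResolvent {Re λ > ω} R`, and the identification with the generator.

## References

* K.-J. Engel, R. Nagel, *One-Parameter Semigroups for Linear Evolution Equations*, Springer GTM
  194 (2000), Ch. II Thm. 1.10 and (1.13)–(1.14) (integral representation of the resolvent).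
  [EngelNagel2000]
* T. Kato, *Perturbation Theory for Linear Operators* (1966), IX-§1.3 (1.28) (`R(ζ) = ∫ e^{−ζt}U(t)dt`),
  VIII-§1.1 (pseudo-resolvents). [Kato1966]
* H. Jia, V. Šverák, J. Funct. Anal. 268 (2015), §2 Lemma 2.1 (`ρ(𝓛) ⊇ {Re λ > −¼}` by the
  semigroup/energy method). [JiaSverak2015]
-/

noncomputable section

open MeasureTheory Set Filter Topology Complex
open scoped NNReal

namespace Literature.Analysis.UnboundedOperators

namespace C0Semigroup

variable {E : Type*} [NormedAddCommGroup E] [NormedSpace ℂ E]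

/-- **The Laplace transform of a C₀-semigroup applied to a vector**:
`R(λ) x = ∫_{(0,∞)} e^{−λt} T(t) x dt` (Engel–Nagel II (1.13); total Bochner integral, meaningful
for `Re λ` larger than the growth bound). [cite: EngelNagel2000, Ch. II Thm. 1.10 (1.13)] -/
def laplaceResolventFun (T : C0Semigroup ℂ E) (l : ℂ) (x : E) : E :=
  ∫ t in Ioi (0 : ℝ), Complex.exp (-(l * t)) • T.app (Real.toNNReal t) x

/-- The integrand `t ↦ e^{−λt} T(t) x` is continuous. [cite: EngelNagel2000, Ch. II Thm. 1.10] -/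
theorem continuous_integrand (T : C0Semigroup ℂ E) (l : ℂ) (x : E) :
    Continuous fun t : ℝ => Complex.exp (-(l * t)) • T.app (Real.toNNReal t) x := by
  refine Continuous.smul ?_ ((T.continuous_app x).comp continuous_real_toNNReal)
  exact Complex.continuous_exp.comp ((continuous_const.mul Complex.continuous_ofReal).neg)

/-- Pointwise bound `‖e^{−λt} T(t) x‖ ≤ M ‖x‖ e^{(ω − Re λ)t}` for `t ≥ 0` under the growth bound
`‖T(t)‖ ≤ M e^{ωt}`. [cite: EngelNagel2000, Ch. II Thm. 1.10] -/
theorem norm_integrand_le (T : C0Semigroup ℂ E) {M ω : ℝ}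
    (hM : ∀ t : ℝ≥0, ‖T.app t‖ ≤ M * Real.exp (ω * t)) (l : ℂ) (x : E) {t : ℝ} (ht : 0 ≤ t) :
    ‖Complex.exp (-(l * t)) • T.app (Real.toNNReal t) x‖ ≤ M * ‖x‖ * Real.exp ((ω - l.re) * t) := by
  rw [norm_smul, Complex.norm_exp]
  have hre : (-(l * (t : ℂ))).re = -(l.re * t) := by
    simp [Complex.mul_re, Complex.ofReal_re, Complex.ofReal_im]
  rw [hre]
  have h1 : ‖T.app (Real.toNNReal t) x‖ ≤ M * Real.exp (ω * t) * ‖x‖ := by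
    have h := (T.app (Real.toNNReal t)).le_opNorm x
    refine h.trans (mul_le_mul_of_nonneg_right ?_ (norm_nonneg _))
    have := hM (Real.toNNReal t)
    rwa [Real.coe_toNNReal t ht] at this
  calc Real.exp (-(l.re * t)) * ‖T.app (Real.toNNReal t) x‖
      ≤ Real.exp (-(l.re * t)) * (M * Real.exp (ω * t) * ‖x‖) :=
        mul_le_mul_of_nonneg_left h1 (Real.exp_pos _).le
    _ = M * ‖x‖ * Real.exp ((ω - l.re) * t) := by
        rw [sub_mul, Real.exp_sub, div_eq_mul_inv, ← Real.exp_neg]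
        ring

/-- **Integrability of the Laplace integrand for `Re λ > ω`** (the integral (1.13) "exists for
every `x`"). [cite: EngelNagel2000, Ch. II Thm. 1.10 (i)] -/
theorem integrableOn_integrand (T : C0Semigroup ℂ E) {M ω : ℝ}
    (hM : ∀ t : ℝ≥0, ‖T.app t‖ ≤ M * Real.exp (ω * t)) {l : ℂ} (hl : ω < l.re) (x : E) :
    IntegrableOn (fun t : ℝ => Complex.exp (-(l * t)) • T.app (Real.toNNReal t) x) (Ioi 0) := by
  refine Integrable.mono' ((integrableOn_exp_mul_Ioi (sub_neg.2 hl) 0).const_mul (M * ‖x‖))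
    (continuous_integrand T l x).aestronglyMeasurable ?_
  refine (ae_restrict_iff' measurableSet_Ioi).2 (Eventually.of_forall fun t ht => ?_)
  exact norm_integrand_le T hM l x (le_of_lt ht)

/-- **The bound `‖R(λ) x‖ ≤ M (∫₀^∞ e^{(ω − Re λ)t} dt) ‖x‖`** (Engel–Nagel (1.14):
`‖R(λ)‖ ≤ M/(Re λ − ω)`, here with the integral left unevaluated). [cite: EngelNagel2000, Ch. II Thm. 1.10 (1.14)] -/
theorem norm_laplaceResolventFun_le (T : C0Semigroup ℂ E) {M ω : ℝ}
    (hM : ∀ t : ℝ≥0, ‖T.app t‖ ≤ M * Real.exp (ω * t)) {l : ℂ} (hl : ω < l.re) (x : E) :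
    ‖T.laplaceResolventFun l x‖ ≤
      (M * ∫ t in Ioi (0 : ℝ), Real.exp ((ω - l.re) * t)) * ‖x‖ := by
  rw [laplaceResolventFun]
  calc ‖∫ t in Ioi (0 : ℝ), Complex.exp (-(l * t)) • T.app (Real.toNNReal t) x‖
      ≤ ∫ t in Ioi (0 : ℝ), M * ‖x‖ * Real.exp ((ω - l.re) * t) := by
        refine norm_integral_le_of_norm_le
          ((integrableOn_exp_mul_Ioi (sub_neg.2 hl) 0).const_mul (M * ‖x‖)) ?_
        exact (ae_restrict_iff' measurableSet_Ioi).2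
          (Eventually.of_forall fun t ht => norm_integrand_le T hM l x (le_of_lt ht))
    _ = (M * ∫ t in Ioi (0 : ℝ), Real.exp ((ω - l.re) * t)) * ‖x‖ := by
        rw [integral_const_mul]; ring

/-- Additivity in the vector. [cite: EngelNagel2000, Ch. II Thm. 1.10] -/
theorem laplaceResolventFun_add (T : C0Semigroup ℂ E) {M ω : ℝ}
    (hM : ∀ t : ℝ≥0, ‖T.app t‖ ≤ M * Real.exp (ω * t)) {l : ℂ} (hl : ω < l.re) (x y : E) :
    T.laplaceResolventFun l (x + y) = T.laplaceResolventFun l x + T.laplaceResolventFun l y := by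
  simp only [laplaceResolventFun, map_add, smul_add]
  exact integral_add (integrableOn_integrand T hM hl x) (integrableOn_integrand T hM hl y)

/-- Homogeneity in the vector. [cite: EngelNagel2000, Ch. II Thm. 1.10] -/
theorem laplaceResolventFun_smul (T : C0Semigroup ℂ E) (l : ℂ) (c : ℂ) (x : E) :
    T.laplaceResolventFun l (c • x) = c • T.laplaceResolventFun l x := by
  simp only [laplaceResolventFun, map_smul, smul_comm _ c, integral_smul]

/-- **`R(λ)` as a bounded operator** for `Re λ > ω` (Engel–Nagel II Thm. 1.10 (i) with (1.14)).
[cite: EngelNagel2000, Ch. II Thm. 1.10 (i) and (1.14)] -/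
def laplaceResolventCLM (T : C0Semigroup ℂ E) {M ω : ℝ}
    (hM : ∀ t : ℝ≥0, ‖T.app t‖ ≤ M * Real.exp (ω * t)) {l : ℂ} (hl : ω < l.re) : E →L[ℂ] E :=
  LinearMap.mkContinuous
    { toFun := T.laplaceResolventFun l
      map_add' := laplaceResolventFun_add T hM hl
      map_smul' := laplaceResolventFun_smul T l }
    (M * ∫ t in Ioi (0 : ℝ), Real.exp ((ω - l.re) * t))
    (norm_laplaceResolventFun_le T hM hl)

/-- `laplaceResolventCLM` acts as `laplaceResolventFun`. [cite: EngelNagel2000, Ch. II Thm. 1.10 (1.13)] -/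
theorem laplaceResolventCLM_apply (T : C0Semigroup ℂ E) {M ω : ℝ}
    (hM : ∀ t : ℝ≥0, ‖T.app t‖ ≤ M * Real.exp (ω * t)) {l : ℂ} (hl : ω < l.re) (x : E) :
    T.laplaceResolventCLM hM hl x = T.laplaceResolventFun l x := rfl

/-! ### Eigenvectors: `T(t) v = e^{μt} v ⟹ R(λ) v = (λ − μ)⁻¹ v` -/

/-- **Eigenvector transfer**: if `T(t) v = e^{μt} v` for all `t ≥ 0` then
`R(λ) v = ∫₀^∞ e^{−(λ−μ)t} dt • v = (λ − μ)⁻¹ v` for `Re λ > Re μ` (Engel–Nagel IV-§3 spectral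
mapping for the point spectrum, in its elementary direction). This is the form
`J(λ) v = (λ − μ)⁻¹ v` of eigenvectors used by the Riesz-projection calculus
(`IsPseudoResolvent.circleIntegral_apply_of_apply_eq_inv_smul`). [cite: EngelNagel2000, Ch. II Thm. 1.10 (1.13)] -/
theorem laplaceResolventFun_of_app_eq_exp_smul [CompleteSpace E] (T : C0Semigroup ℂ E) {μ : ℂ}
    {v : E} (hv : ∀ t : ℝ≥0, T.app t v = Complex.exp (μ * t) • v) {l : ℂ} (hl : μ.re < l.re) :
    T.laplaceResolventFun l v = (l - μ)⁻¹ • v := by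
  rw [laplaceResolventFun]
  have hpt : ∀ t ∈ Ioi (0 : ℝ), Complex.exp (-(l * t)) • T.app (Real.toNNReal t) v =
      Complex.exp ((μ - l) * t) • v := by
    intro t ht
    rw [hv, smul_smul, ← Complex.exp_add, Real.coe_toNNReal t (le_of_lt ht)]
    congr 1
    congr 1
    ring
  rw [setIntegral_congr_fun measurableSet_Ioi hpt, integral_smul_const,
    integral_exp_mul_complex_Ioi (by simpa using hl) 0]
  congr 1
  rw [Complex.ofReal_zero, mul_zero, Complex.exp_zero, neg_div, one_div, ← inv_neg, neg_sub]

end C0Semigroup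

end Literature.Analysis.UnboundedOperators
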